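import Mathlib
import HarnessLib
import Summits.Ventures.LatticeQCDFlow.Scaling.AcceptanceGiniFloorSharpWitness

/-!
# LatticeQCDFlow / Scaling — the constant `8/9` in `acc ≥ (8/9)·ESS` is best possible: equally
# likely, equally spaced weights give `acc = (8/9 + 2/(9m(m + 1)))·ESS`

HONEST FRAMING: exact (Metropolis-corrected) sampling algorithms for lattice gauge theory;
figures of merit are autocorrelation/cost numbers at stated couplings and volumes; no
continuum-physics claim.

Venture `LatticeQCDFlow` (cell pub-lqcd), topic `Scaling`; FANOUT row 3 (`s0-u1-a`, S0-B
implementation A, GEN-8).  NEW WORK of the cell (three finite sums), not a published result; NO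
definition is introduced.  Witness companion of row 3's `Scaling/AcceptanceEssEightNinths`
(`(8/9)·ESS ≤ acc` for every finite normalised pair); the laws are written out in every statement,
as in row 3's `Scaling/AcceptanceGiniFloorSharpWitness` (GEN-6, imported for
`sum_fin_fin_eq_sum_range_range`).

## The ramp with a corner at zero (model `q ≡ 1/m` on `Fin m`, `m ≥ 1`; target `p_k = 2(k + 1)/(m(m + 1))`,
## i.e. weights `w_k = 2(k + 1)/(m + 1)`, mean one)

* `sum_range_succ_sq_real`, `sum_range_range_min_succ_real` — `Σ (k+1)²` and
  `Σ_iΣ_j min(i+1, j+1) = m(m+1)(2m+1)/6` (the Gauss sum `Σ (k+1) = m(m+1)/2` is re-derived inline;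
  the tree has it in a QFT module not worth importing here);
* `cornerRamp_accRate` — `acc = (2m + 1)/(3m)`; `cornerRamp_essFrac` — `ESS = 3(m + 1)/(2(2m + 1))`;
* **`cornerRamp_accRate_eq_mul_essFrac`** — `acc = (8/9 + 2/(9m(m + 1)))·ESS` exactly
  (`m = 1, 2, 3`: `acc/ESS = 1, 25/27, 49/54`);
* **`exists_accRate_lt_mul_essFrac`** — for every `c > 8/9` there is a finite normalised pair with
  POSITIVE target and model and `acc < c·ESS`: no constant above `8/9` can replace it in
  `eight_ninths_essFrac_le_accRate`.

NOT CLAIMED: attainment of `8/9` on a finite space (the infimum is the uniform law on an interval,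
approached as `m → ∞`); anything about a trained flow; nothing re-scored.
-/

namespace Summit.Ventures.LatticeQCDFlow.Theory2

open Finset
open Summit.Ventures.LatticeQCDFlow.Exactness

/-! ### Three sums -/

/-- `Σ_{k<m} (k + 1)² = m(m + 1)(2m + 1)/6`. [folklore] -/
theorem sum_range_succ_sq_real (m : ℕ) :
    ∑ k ∈ range m, ((k : ℝ) + 1) ^ 2 = (m : ℝ) * (m + 1) * (2 * m + 1) / 6 := by
  induction m with
  | zero => simp
  | succ n ih =>
    rw [sum_range_succ, ih]
    push_cast
    ring

/-- `Σ_{i<m} Σ_{j<m} min(i + 1, j + 1) = m(m + 1)(2m + 1)/6` (the value `k` is the minimum of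
`2(m − k) + 1` ordered pairs). [folklore] -/
theorem sum_range_range_min_succ_real (m : ℕ) :
    ∑ i ∈ range m, ∑ j ∈ range m, min ((i : ℝ) + 1) ((j : ℝ) + 1)
      = (m : ℝ) * (m + 1) * (2 * m + 1) / 6 := by
  have gauss : ∀ n : ℕ, ∑ k ∈ range n, ((k : ℝ) + 1) = (n : ℝ) * (n + 1) / 2 := by
    intro n
    induction n with
    | zero => simp
    | succ n ih =>
      rw [sum_range_succ, ih]
      push_cast
      ring
  induction m with
  | zero => simp
  | succ n ih =>
    rw [sum_range_succ]
    simp_rw [sum_range_succ]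
    rw [sum_add_distrib, ih, min_self]
    have h1 : ∑ i ∈ range n, min ((i : ℝ) + 1) ((n : ℝ) + 1) = (n : ℝ) * (n + 1) / 2 := by
      rw [← gauss n]
      refine sum_congr rfl fun i hi => min_eq_left ?_
      have := mem_range.1 hi
      exact_mod_cast (by omega : i + 1 ≤ n + 1)
    have h2 : ∑ j ∈ range n, min ((n : ℝ) + 1) ((j : ℝ) + 1) = (n : ℝ) * (n + 1) / 2 := by
      rw [← gauss n]
      refine sum_congr rfl fun j hj => min_eq_right ?_
      have := mem_range.1 hj
      exact_mod_cast (by omega : j + 1 ≤ n + 1)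
    rw [h1, h2]
    push_cast
    ring

/-! ### The corner ramp -/

/-- The ramp model is normalised: `Σ_k 1/m = 1` (`m ≥ 1`). -/
theorem cornerRamp_model_sum {m : ℕ} (hm : 1 ≤ m) : ∑ _k : Fin m, ((m : ℝ))⁻¹ = 1 := by
  have hmne : (m : ℝ) ≠ 0 := by exact_mod_cast (by omega : m ≠ 0)
  rw [sum_const, card_univ, Fintype.card_fin, nsmul_eq_mul, mul_inv_cancel₀ hmne]

/-- The ramp target is normalised: `Σ_k 2(k + 1)/(m(m + 1)) = 1`. -/
theorem cornerRamp_target_sum {m : ℕ} (hm : 1 ≤ m) :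
    ∑ k : Fin m, 2 * (((k : ℕ) : ℝ) + 1) / (m * (m + 1)) = 1 := by
  have hm0 : (0 : ℝ) < m := by exact_mod_cast (by omega : 0 < m)
  have hden : (m : ℝ) * (m + 1) ≠ 0 := by positivity
  have h : ∑ k : Fin m, 2 * (((k : ℕ) : ℝ) + 1) / (m * (m + 1))
      = (2 / ((m : ℝ) * (m + 1))) * ∑ k ∈ range m, ((k : ℝ) + 1) := by
    rw [Fin.sum_univ_eq_sum_range (fun k => 2 * ((k : ℝ) + 1) / ((m : ℝ) * (m + 1))) m, mul_sum]
    exact sum_congr rfl fun k _ => by ring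
  have gauss : ∀ n : ℕ, ∑ k ∈ range n, ((k : ℝ) + 1) = (n : ℝ) * (n + 1) / 2 := by
    intro n
    induction n with
    | zero => simp
    | succ n ih =>
      rw [sum_range_succ, ih]
      push_cast
      ring
  rw [h, gauss m]
  field_simp

/-- The ramp weights: `w_k = 2(k + 1)/(m + 1)`. -/
theorem cornerRamp_weight {m : ℕ} (hm : 1 ≤ m) (k : Fin m) :
    weight (fun k : Fin m => 2 * (((k : ℕ) : ℝ) + 1) / (m * (m + 1))) (fun _ => ((m : ℝ))⁻¹) k
      = 2 * (((k : ℕ) : ℝ) + 1) / (m + 1) := by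
  have hm0 : (0 : ℝ) < m := by exact_mod_cast (by omega : 0 < m)
  have hmne : (m : ℝ) ≠ 0 := hm0.ne'
  have hm1 : (m : ℝ) + 1 ≠ 0 := by positivity
  rw [weight]
  field_simp

/-- **Acceptance of the corner ramp**: `acc = (2m + 1)/(3m)`. -/
theorem cornerRamp_accRate {m : ℕ} (hm : 1 ≤ m) :
    accRate (fun k : Fin m => 2 * (((k : ℕ) : ℝ) + 1) / (m * (m + 1))) (fun _ => ((m : ℝ))⁻¹)
      = (2 * (m : ℝ) + 1) / (3 * m) := by
  have hm0 : (0 : ℝ) < m := by exact_mod_cast (by omega : 0 < m)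
  have hmne : (m : ℝ) ≠ 0 := hm0.ne'
  have hC : 0 ≤ 2 / ((m : ℝ) * (m + 1) * m) := by positivity
  unfold accRate
  have e : ∀ i j : Fin m,
      min (2 * (((i : ℕ) : ℝ) + 1) / (m * (m + 1)) * ((m : ℝ))⁻¹)
          (2 * (((j : ℕ) : ℝ) + 1) / (m * (m + 1)) * ((m : ℝ))⁻¹)
        = 2 / ((m : ℝ) * (m + 1) * m) * min (((i : ℕ) : ℝ) + 1) (((j : ℕ) : ℝ) + 1) := by
    intro i j
    rw [mul_min_of_nonneg _ _ hC]
    congr 1 <;> field_simp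
  simp_rw [e]
  rw [sum_fin_fin_eq_sum_range_range m (fun i j => 2 / ((m : ℝ) * (m + 1) * m)
    * min ((i : ℝ) + 1) ((j : ℝ) + 1))]
  simp_rw [← mul_sum]
  rw [sum_range_range_min_succ_real]
  field_simp
  ring

/-- **ESS fraction of the corner ramp**: `ESS = 3(m + 1)/(2(2m + 1))`. -/
theorem cornerRamp_essFrac {m : ℕ} (hm : 1 ≤ m) :
    essFrac (fun k : Fin m => 2 * (((k : ℕ) : ℝ) + 1) / (m * (m + 1))) (fun _ => ((m : ℝ))⁻¹)
      = 3 * ((m : ℝ) + 1) / (2 * (2 * m + 1)) := by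
  have hm0 : (0 : ℝ) < m := by exact_mod_cast (by omega : 0 < m)
  have hmne : (m : ℝ) ≠ 0 := hm0.ne'
  have hq : ∀ k : Fin m, (0 : ℝ) < ((m : ℝ))⁻¹ := fun _ => inv_pos.2 hm0
  have hS1 := sum_mul_weight hq (cornerRamp_target_sum hm)
  have hS2 : ∑ k : Fin m, ((m : ℝ))⁻¹
      * weight (fun k : Fin m => 2 * (((k : ℕ) : ℝ) + 1) / (m * (m + 1))) (fun _ => ((m : ℝ))⁻¹) k ^ 2
      = 2 * (2 * (m : ℝ) + 1) / (3 * (m + 1)) := by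
    simp_rw [cornerRamp_weight hm]
    have h : ∑ k : Fin m, ((m : ℝ))⁻¹ * (2 * (((k : ℕ) : ℝ) + 1) / (m + 1)) ^ 2
        = (4 / ((m : ℝ) * (m + 1) ^ 2)) * ∑ k ∈ range m, ((k : ℝ) + 1) ^ 2 := by
      rw [Fin.sum_univ_eq_sum_range (fun k => ((m : ℝ))⁻¹ * (2 * ((k : ℝ) + 1) / (m + 1)) ^ 2) m,
        mul_sum]
      refine sum_congr rfl fun k _ => ?_
      field_simp
      ring
    rw [h, sum_range_succ_sq_real]
    field_simp
    ring
  rw [essFrac, hS1, hS2]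
  field_simp

/-- **The corner ramp has `acc = (8/9 + 2/(9m(m + 1)))·ESS`** exactly (`m = 1`: hit-or-miss-free
two-point... `acc = ESS`; `m = 2`: `25/27`; `m = 3`: `49/54`; `↓ 8/9`). -/
theorem cornerRamp_accRate_eq_mul_essFrac {m : ℕ} (hm : 1 ≤ m) :
    accRate (fun k : Fin m => 2 * (((k : ℕ) : ℝ) + 1) / (m * (m + 1))) (fun _ => ((m : ℝ))⁻¹)
      = (8 / 9 + 2 / (9 * (m : ℝ) * (m + 1)))
        * essFrac (fun k : Fin m => 2 * (((k : ℕ) : ℝ) + 1) / (m * (m + 1))) (fun _ => ((m : ℝ))⁻¹) := by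
  have hm0 : (0 : ℝ) < m := by exact_mod_cast (by omega : 0 < m)
  rw [cornerRamp_accRate hm, cornerRamp_essFrac hm]
  field_simp
  ring

/-- **No constant above `8/9`.**  For every `c > 8/9` there are `m ≥ 1` and a normalised pair on
`Fin m` with positive target and model and `acc < c·ESS` (the corner ramp with
`2/(9m(m + 1)) < c − 8/9`). [folklore] -/
theorem exists_accRate_lt_mul_essFrac {c : ℝ} (hc : 8 / 9 < c) :
    ∃ (m : ℕ) (p q : Fin m → ℝ), (∀ k, 0 < p k) ∧ (∀ k, 0 < q k) ∧ ∑ k, p k = 1 ∧ ∑ k, q k = 1 ∧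
      accRate p q < c * essFrac p q := by
  obtain ⟨m, hm⟩ := exists_nat_gt (1 / (c - 8 / 9))
  have hc' : 0 < c - 8 / 9 := by linarith
  have hm0 : (0 : ℝ) < m := lt_trans (by positivity) hm
  have hm1 : 1 ≤ m := by exact_mod_cast (show (0 : ℝ) < m from hm0)
  refine ⟨m, fun k => 2 * (((k : ℕ) : ℝ) + 1) / (m * (m + 1)), fun _ => ((m : ℝ))⁻¹, ?_, ?_,
    cornerRamp_target_sum hm1, cornerRamp_model_sum hm1, ?_⟩
  · intro k; positivity
  · intro k; positivity
  · rw [cornerRamp_accRate_eq_mul_essFrac hm1]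
    have hE : 0 < essFrac (fun k : Fin m => 2 * (((k : ℕ) : ℝ) + 1) / (m * (m + 1)))
        (fun _ => ((m : ℝ))⁻¹) := by
      rw [cornerRamp_essFrac hm1]; positivity
    refine mul_lt_mul_of_pos_right ?_ hE
    -- `2/(9m(m+1)) ≤ 2/(9m) < c − 8/9` since `m > 1/(c − 8/9)`
    have h1 : 2 / (9 * (m : ℝ) * (m + 1)) ≤ 1 / m := by
      rw [div_le_div_iff₀ (by positivity) hm0]
      nlinarith
    have h2 : 1 / (m : ℝ) < c - 8 / 9 := by
      rw [div_lt_iff₀ hm0]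
      have := (div_lt_iff₀ hc').mp hm
      linarith
    linarith

end Summit.Ventures.LatticeQCDFlow.Theory2
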